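import Summits.QuantumFields.YangMills.Theorems.FlatTubeReductionDiagonalPhaseSecondOrder
import Summits.QuantumFields.YangMills.Theorems.FlatTubeReductionCoreAmplitudes
import HarnessLib

/-!
# The two pointwise bounds of the diagonal Laplace exponent on the pinned core AS POLYNOMIALS IN THE GAUSSIAN LEVELS: `|X₁| ≤ a₁·(1 + N + N_v + N_v')`,
# `|X − X₁| ≤ a₂ℓ·(1 + N + N_v + N_v') + a₂q·(1 + N_v + N_v')²` with `a₁ ∝ τ_u`, `a₂ℓ ∝ τ_u², σ, √σ`, `a₂q ∝ σβ^{-1/2}, τ_uβ^{-1/2}` — no `u`-independent junk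
# (route `FlatTubeReduction`, crux K1 `NearFlatRatioLaw` stmt-QuantumFields-24720; seat `ym-line-ftr-p1` g13; rate twin «ratepack-v3 / frozen fibres»; R2b1 RECORD rung — no summit
# statement is proved here)

WHY (memo `Cruxes/NearFlatRatioLaw/Lines/ratepack-v3-frozen-g12.md` §6).  The core+tail moment sandwich `…DiagonalMomentSandwichCore.fpBOKernel_diag_two_sided_moment_core` consumes
moments of `M₂ = ∫_d|X − X₁|` and `M_R = ∫_d X²e^{|X|}` against the reference density, and `…ReferenceMoments.reference_moment_le` (with the re-weighted profile `Ω·(1+β‖v̂‖²)^j`) integrates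
weights that are POLYNOMIAL in the levels `N = β·kinDefect`, `N_v = β‖v̂‖²`, `N_v' = β‖v̂'‖²`.  This file turns lane A's `E₁` (`abs_diagX1_conj_le_E1`) and the junk-free `E₂'`
(`…DiagonalPhaseSecondOrder.abs_diagX_conj_sub_diagX1_le_E2'`) into that form, using `…CoreAmplitudes.kineticCross_le_levels` for the gauge amplitudes (colour pinning + jumps on the core):
* ★★ `diagX1_conj_le_levels` — `|X₁(d,p)| ≤ τ_u·(24c_K + 80N₃)·(1 + N + N_v + N_v')`, `c_K = |E|(24302L² + 6βε²)`;
* ★★ `diagX_conj_sub_diagX1_le_levels` — `|X(d,p) − X₁(d,p)| ≤ [τ_u²(48c_K + 7.25·10⁷N₃) + 25σN₃ + 3456N_P√σ]·(1 + N + N_v + N_v') + 4N_P[σ(14688β^{-1/2} + 1401138β⁻¹) + 7·10⁵τ_uβ^{-1/2}]·(1 + N_v + N_v')²`.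
Every coefficient carries `τ_u`, `σ` (`≥ L³S₁(u) = O(τ_u⁴)`) or `√σ`, except through `τ_u·β^{-1/2}` (the differenced cubic junk; AM–GM downstream: `τ_uβ^{-1/2} ≤ ½(τ_u²β^{-1/4} + β^{-3/4})`, `β^{-3/4} ≪ λ_b²`).
HONEST FRAMING: real-inequality bookkeeping; femto rung R2b1 (RECORD label); not infinite volume, not a gap, not Clay.  No defs, no named facts, no `sorry`.
-/

set_option autoImplicit false

noncomputable section

open MeasureTheory Filter Topology Real
open scoped BigOperators Matrix
open Literature.MathematicalPhysics.QuantumFieldTheory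
open Literature.MathematicalPhysics.QuantumLattice

namespace Summit.QuantumFields.YangMills.Theorems.FemtoTransferGap.RateTube

open Summit.QuantumFields.YangMills.Theorems.FemtoTransferGap
open Summit.QuantumFields.YangMills.Theorems.FemtoTransferGap.TwoLattice
open Summit.QuantumFields.YangMills.Theorems.FemtoTransferGap.TwoLattice.ConstTube
open Summit.QuantumFields.YangMills.Theorems.FemtoTransferGap.TwoLattice.Avg
open Summit.QuantumFields.YangMills.Theorems.FemtoTransferGap.TwoLattice.Cov
open Summit.QuantumFields.YangMills.Theorems.FemtoTransferGap.TwoLattice.Toron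
open Summit.QuantumFields.YangMills.Theorems.FemtoTransferGap.TwoLattice.Stiff (LinkSpace)

variable {L : ℕ} [NeZero L]

/-! ## §1 ★★ The first-order part in the levels -/

set_option maxHeartbeats 800000 in
/-- ★★ **`|X₁(d,p)| ≤ τ_u·(24c_K + 80N₃)·(1 + N + N_v + N_v')`** on the pinned core (`c_K = |E|(24302L² + 6βε²)`, `N₃ = |P×Fin 3|`), uniformly over the colour rotation `d`.
Hypotheses: `β ≥ 0`; `v, v'` on the cap; `colourMean g ∈ fpBall ε`; the core smallness `3L(√kin + 5√2‖v̂‖ + √2‖v̂'‖) < 1`; `Σ_a u⃗_{k,a}² ≤ τ_u²`. [cite: Luscher1983, §3] -/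
theorem diagX1_conj_le_levels {β : ℝ} (hβ : 0 ≤ β) (u : GaugeConfig 3 1 SU2) {τu : ℝ} (hτu0 : 0 ≤ τu) (hu : ∀ k : Fin 3, ∑ a, vecPart (u (0, k)) a ^ 2 ≤ τu ^ 2)
    {v v' : Edge 3 L → Fin 3 → ℝ} (hv1 : ∀ e, ∑ a, v e a ^ 2 ≤ 1) (hv'1 : ∀ e, ∑ a, v' e a ^ 2 ≤ 1) {g : Site 3 L → SU2} {ε : ℝ} (hW : colourMean L g ∈ fpBall ε)
    (hsmall : 3 * L * (Real.sqrt (kinDefect L (orthoTube L 1 v) (orthoTube L 1 v') g) + 5 * Real.sqrt 2 * ‖linkEmbed L v‖ + Real.sqrt 2 * ‖linkEmbed L v'‖) < 1) (d : SU2) :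
    |diagX1 L β (slowLin (gaugeTransform (fun _ : Site 3 1 => d) u)) v v' g| ≤
      τu * (24 * ((Fintype.card (Edge 3 L) : ℝ) * (24302 * (L : ℝ) ^ 2 + 6 * (β * ε ^ 2))) + 80 * (Fintype.card (Plaquette 3 L × Fin 3) : ℝ)) *
        (1 + β * kinDefect L (orthoTube L 1 v) (orthoTube L 1 v') g + β * ‖linkEmbed L v‖ ^ 2 + β * ‖linkEmbed L v'‖ ^ 2) := by
  have h1 := abs_diagX1_conj_le_E1 (L := L) hβ u v v' hτu0 hu g d
  have hK := kineticCross_le_levels (L := L) hβ hv1 hv'1 hW hsmall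
  refine h1.trans ?_
  set N := β * kinDefect L (orthoTube L 1 v) (orthoTube L 1 v') g with hN
  set Nv := β * ‖linkEmbed L v‖ ^ 2 with hNv
  set Nv' := β * ‖linkEmbed L v'‖ ^ 2 with hNv'
  set cE : ℝ := (Fintype.card (Edge 3 L) : ℝ) with hcE
  set N3 : ℝ := (Fintype.card (Plaquette 3 L × Fin 3) : ℝ) with hN3
  set K : ℝ := β * ∑ e : Edge 3 L, ‖vecPart (g (e.1.shift e.2))‖ * ‖vecPart (linkM L v v' g e)‖ with hKdef
  have hN0 : 0 ≤ N := mul_nonneg hβ (kinDefect_nonneg _ _ _)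
  have hNv0 : 0 ≤ Nv := mul_nonneg hβ (sq_nonneg _)
  have hNv'0 : 0 ≤ Nv' := mul_nonneg hβ (sq_nonneg _)
  have hcE0 : 0 ≤ cE := Nat.cast_nonneg _
  have hN30 : 0 ≤ N3 := Nat.cast_nonneg _
  have hL1 : (1 : ℝ) ≤ (L : ℝ) ^ 2 := one_le_pow₀ (by exact_mod_cast NeZero.one_le)
  have hβε : 0 ≤ β * ε ^ 2 := mul_nonneg hβ (sq_nonneg _)
  -- the kinetic cross weight in the levels
  have hK' : K ≤ cE * (24302 * (L : ℝ) ^ 2 + 6 * (β * ε ^ 2)) * (1 + N + Nv + Nv') := by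
    refine hK.trans ?_
    have hLN : 0 ≤ (L : ℝ) ^ 2 * N := mul_nonneg (sq_nonneg _) hN0
    have hLNv' : 0 ≤ (L : ℝ) ^ 2 * Nv' := mul_nonneg (sq_nonneg _) hNv'0
    have hb1 : 0 ≤ β * ε ^ 2 * N := mul_nonneg hβε hN0
    have hb2 : 0 ≤ β * ε ^ 2 * Nv := mul_nonneg hβε hNv0
    have hb3 : 0 ≤ β * ε ^ 2 * Nv' := mul_nonneg hβε hNv'0
    have this : 486 * (L : ℝ) ^ 2 * N + 24302 * (L : ℝ) ^ 2 * Nv + 974 * (L : ℝ) ^ 2 * Nv' + 6 * (β * ε ^ 2) ≤ (24302 * (L : ℝ) ^ 2 + 6 * (β * ε ^ 2)) * (1 + N + Nv + Nv') := by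
      nlinarith only [hLN, hLNv', hb1, hb2, hb3, sq_nonneg (L : ℝ), hN0, hNv0, hNv'0, hβε]
    have h2 := mul_le_mul_of_nonneg_left this hcE0
    linarith [h2]
  -- the two terms of `E₁`
  have e1 : β * (12 * ∑ e : Edge 3 L, (2 * τu) * ‖vecPart (g (e.1.shift e.2))‖ * ‖vecPart (linkM L v v' g e)‖) = 24 * τu * K := by
    rw [hKdef]; simp only [Finset.mul_sum]
    exact Finset.sum_congr rfl fun e _ => by ring
  have e2 : β * (40 * (2 * τu) * N3 * (‖linkEmbed L v‖ ^ 2 + ‖linkEmbed L v'‖ ^ 2)) = 80 * τu * N3 * (Nv + Nv') := by rw [hNv, hNv']; ring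
  rw [e1, e2]
  have hle : Nv + Nv' ≤ 1 + N + Nv + Nv' := by linarith
  have t1 := mul_le_mul_of_nonneg_left hK' (by positivity : (0 : ℝ) ≤ 24 * τu)
  have t2 := mul_le_mul_of_nonneg_left hle (by positivity : (0 : ℝ) ≤ 80 * τu * N3)
  linarith only [t1, t2]

/-! ## §2 ★★ The junk-free second-order part in the levels -/

set_option maxHeartbeats 1600000 in
/-- ★★ **`|X(d,p) − X₁(d,p)|` IN THE LEVELS, WITHOUT JUNK.**  Under the hypotheses of `diagX1_conj_le_levels` plus: `β ≥ 1`; `L³S₁(u) ≤ σ < 2`, `0 ≤ σ`; `τ_u ≤ 1/40`; the fibre data on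
the cap with `‖v̂‖ + ‖v̂'‖ ≤ 1/30`:
`|X − X₁| ≤ [τ_u²(48c_K + 7.25·10⁷N₃) + 25σN₃ + 3456N_P√σ]·(1 + N + N_v + N_v') + 4N_P·[σ(14688β^{-1/2} + 1401138β⁻¹) + 7·10⁵τ_uβ^{-1/2}]·(1 + N_v + N_v')²`. [cite: Luscher1983, §3] -/
theorem diagX_conj_sub_diagX1_le_levels {β : ℝ} (hβ : 1 ≤ β) (u : GaugeConfig 3 1 SU2) {τu : ℝ} (hτu0 : 0 ≤ τu) (hτu : τu ≤ 1 / 40)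
    (hu : ∀ k : Fin 3, ∑ a, vecPart (u (0, k)) a ^ 2 ≤ τu ^ 2) {σ : ℝ} (hσ : σ < 2) (hσ0 : 0 ≤ σ) (hS : (L : ℝ) ^ 3 * wilsonAction su2Rep u ≤ σ)
    {v v' : Edge 3 L → Fin 3 → ℝ} (hv : v ∈ capBalancedSet L) (hv' : v' ∈ capBalancedSet L) (hrr : ‖linkEmbed L v‖ + ‖linkEmbed L v'‖ ≤ 1 / 30)
    {g : Site 3 L → SU2} {ε : ℝ} (hW : colourMean L g ∈ fpBall ε)
    (hsmall : 3 * L * (Real.sqrt (kinDefect L (orthoTube L 1 v) (orthoTube L 1 v') g) + 5 * Real.sqrt 2 * ‖linkEmbed L v‖ + Real.sqrt 2 * ‖linkEmbed L v'‖) < 1) (d : SU2) :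
    |diagX L β (gaugeTransform (fun _ : Site 3 1 => d) u) v v' g - diagX1 L β (slowLin (gaugeTransform (fun _ : Site 3 1 => d) u)) v v' g| ≤
      (τu ^ 2 * (48 * ((Fintype.card (Edge 3 L) : ℝ) * (24302 * (L : ℝ) ^ 2 + 6 * (β * ε ^ 2))) + 72500000 * (Fintype.card (Plaquette 3 L × Fin 3) : ℝ)) +
          25 * σ * (Fintype.card (Plaquette 3 L × Fin 3) : ℝ) + 3456 * (Fintype.card (Plaquette 3 L) : ℝ) * Real.sqrt σ) *
        (1 + β * kinDefect L (orthoTube L 1 v) (orthoTube L 1 v') g + β * ‖linkEmbed L v‖ ^ 2 + β * ‖linkEmbed L v'‖ ^ 2) +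
      4 * (Fintype.card (Plaquette 3 L) : ℝ) * (σ * (14688 * (Real.sqrt β)⁻¹ + 1401138 * β⁻¹) + 700000 * τu * (Real.sqrt β)⁻¹) *
        (1 + β * ‖linkEmbed L v‖ ^ 2 + β * ‖linkEmbed L v'‖ ^ 2) ^ 2 := by
  have hβ0 : 0 < β := by linarith
  have hv1 : ∀ e, ∑ a, v e a ^ 2 ≤ 1 := sum_sq_le_one_of_cap L hv.2
  have hv'1 : ∀ e, ∑ a, v' e a ^ 2 ≤ 1 := sum_sq_le_one_of_cap L hv'.2
  set r := ‖linkEmbed L v‖ with hr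
  set r' := ‖linkEmbed L v'‖ with hr'
  have hr0 : 0 ≤ r := norm_nonneg _
  have hr'0 : 0 ≤ r' := norm_nonneg _
  -- componentwise bound `τ = r + r'`
  have hvτ : ∀ (e : Edge 3 L) (c : Fin 3), |v e c| ≤ r + r' := fun e c => by
    have h := abs_apply_le_norm (linkEmbed L v) e c
    rw [linkEmbed_apply] at h; rw [hr]; linarith
  have hvτ' : ∀ (e : Edge 3 L) (c : Fin 3), |v' e c| ≤ r + r' := fun e c => by
    have h := abs_apply_le_norm (linkEmbed L v') e c
    rw [linkEmbed_apply] at h; rw [hr']; linarith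
  have h2 := abs_diagX_conj_sub_diagX1_le_E2' (L := L) hβ0.le u hv hv' hrr hσ hσ0 hS hvτ hvτ' hτu0 hτu hu g d
  have hK := kineticCross_le_levels (L := L) hβ0.le hv1 hv'1 hW hsmall
  refine h2.trans ?_
  rw [← hr, ← hr'] at hK ⊢
  set N := β * kinDefect L (orthoTube L 1 v) (orthoTube L 1 v') g with hN
  set cE : ℝ := (Fintype.card (Edge 3 L) : ℝ) with hcE
  set N3 : ℝ := (Fintype.card (Plaquette 3 L × Fin 3) : ℝ) with hN3
  set NP : ℝ := (Fintype.card (Plaquette 3 L) : ℝ) with hNP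
  set K : ℝ := β * ∑ e : Edge 3 L, ‖vecPart (g (e.1.shift e.2))‖ * ‖vecPart (linkM L v v' g e)‖ with hKdef
  have hN0 : 0 ≤ N := mul_nonneg hβ0.le (kinDefect_nonneg _ _ _)
  have hNv0 : 0 ≤ β * r ^ 2 := mul_nonneg hβ0.le (sq_nonneg _)
  have hNv'0 : 0 ≤ β * r' ^ 2 := mul_nonneg hβ0.le (sq_nonneg _)
  have hcE0 : 0 ≤ cE := Nat.cast_nonneg _
  have hN30 : 0 ≤ N3 := Nat.cast_nonneg _
  have hNP0 : 0 ≤ NP := Nat.cast_nonneg _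
  have hL1 : (1 : ℝ) ≤ (L : ℝ) ^ 2 := one_le_pow₀ (by exact_mod_cast NeZero.one_le)
  have hβε : 0 ≤ β * ε ^ 2 := mul_nonneg hβ0.le (sq_nonneg _)
  have hsβ : 0 < Real.sqrt β := Real.sqrt_pos.mpr hβ0
  have hsβi : 0 ≤ (Real.sqrt β)⁻¹ := inv_nonneg.mpr hsβ.le
  have hβi : 0 ≤ β⁻¹ := inv_nonneg.mpr hβ0.le
  have hsσ : 0 ≤ Real.sqrt σ := Real.sqrt_nonneg _
  -- levels of the componentwise bound
  set S := β * r ^ 2 + β * r' ^ 2 with hSdef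
  have hS0 : 0 ≤ S := by positivity
  have hτ2 : β * (r + r') ^ 2 ≤ 2 * S := by rw [hSdef]; exact sq_sum_le_levels β r r' hβ0.le
  have hx0 : 0 ≤ β * (r + r') ^ 2 := mul_nonneg hβ0.le (sq_nonneg (r + r'))
  have hτ3 : β * (r + r') ^ 3 ≤ (Real.sqrt β)⁻¹ * (2 * S + 4 * S ^ 2) := by
    have h := cubic_le_levels hβ0 (by positivity : 0 ≤ r + r')
    refine h.trans (mul_le_mul_of_nonneg_left ?_ hsβi)
    nlinarith only [hτ2, hx0, hS0]
  have hτ4 : β * (r + r') ^ 4 ≤ β⁻¹ * (4 * S ^ 2) := by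
    rw [quartic_eq_levels hβ0.ne']
    refine mul_le_mul_of_nonneg_left ?_ hβi
    nlinarith only [hτ2, hx0, hS0]
  -- the kinetic cross weight in the levels
  have hK' : K ≤ cE * (24302 * (L : ℝ) ^ 2 + 6 * (β * ε ^ 2)) * (1 + N + β * r ^ 2 + β * r' ^ 2) := by
    refine hK.trans ?_
    have hLN : 0 ≤ (L : ℝ) ^ 2 * N := mul_nonneg (sq_nonneg _) hN0
    have hLNv' : 0 ≤ (L : ℝ) ^ 2 * (β * r' ^ 2) := mul_nonneg (sq_nonneg _) hNv'0
    have hb1 : 0 ≤ β * ε ^ 2 * N := mul_nonneg hβε hN0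
    have hb2 : 0 ≤ β * ε ^ 2 * (β * r ^ 2) := mul_nonneg hβε hNv0
    have hb3 : 0 ≤ β * ε ^ 2 * (β * r' ^ 2) := mul_nonneg hβε hNv'0
    have this : 486 * (L : ℝ) ^ 2 * N + 24302 * (L : ℝ) ^ 2 * (β * r ^ 2) + 974 * (L : ℝ) ^ 2 * (β * r' ^ 2) + 6 * (β * ε ^ 2) ≤
        (24302 * (L : ℝ) ^ 2 + 6 * (β * ε ^ 2)) * (1 + N + β * r ^ 2 + β * r' ^ 2) := by
      nlinarith only [hLN, hLNv', hb1, hb2, hb3, sq_nonneg (L : ℝ), hN0, hNv0, hNv'0, hβε]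
    have h2 := mul_le_mul_of_nonneg_left this hcE0
    linarith [h2]
  have hK0 : 0 ≤ K := by rw [hKdef]; exact mul_nonneg hβ0.le (Finset.sum_nonneg fun e _ => mul_nonneg (norm_nonneg _) (norm_nonneg _))
  -- rewrite the E₂' expression term by term
  have e1 : β * (48 * ∑ e : Edge 3 L, τu ^ 2 * ‖vecPart (g (e.1.shift e.2))‖ * ‖vecPart (linkM L v v' g e)‖) = 48 * τu ^ 2 * K := by
    rw [hKdef]; simp only [Finset.mul_sum]
    exact Finset.sum_congr rfl fun e _ => by ring
  -- bound each bracket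
  have hbr : ∀ w : ℝ, 0 ≤ w → β / 2 * (σ / 2 * (10 * Real.sqrt N3 * w) ^ 2 +
        NP * (1728 * (r + r') ^ 2 * Real.sqrt σ + σ / 2 * (29376 * (r + r') ^ 3 + 700569 * (r + r') ^ 4) + 700000 * τu * (r + r') ^ 3) +
        145000000 * N3 * τu ^ 2 * w ^ 2) ≤
      25 * σ * N3 * (β * w ^ 2) + 1728 * NP * Real.sqrt σ * S + NP * (σ / 2) * (14688 * (Real.sqrt β)⁻¹ * (2 * S + 4 * S ^ 2) + 700569 / 2 * (β⁻¹ * (4 * S ^ 2))) +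
        350000 * NP * τu * ((Real.sqrt β)⁻¹ * (2 * S + 4 * S ^ 2)) + 72500000 * N3 * τu ^ 2 * (β * w ^ 2) := by
    intro w hw
    have hN3s : Real.sqrt N3 ^ 2 = N3 := Real.sq_sqrt hN30
    have t1 : β / 2 * (σ / 2 * (10 * Real.sqrt N3 * w) ^ 2) = 25 * σ * N3 * (β * w ^ 2) := by
      have : (10 * Real.sqrt N3 * w) ^ 2 = 100 * Real.sqrt N3 ^ 2 * w ^ 2 := by ring
      rw [this, hN3s]; ring
    have t2 : β / 2 * (NP * (1728 * (r + r') ^ 2 * Real.sqrt σ)) ≤ 1728 * NP * Real.sqrt σ * S := by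
      have : β / 2 * (NP * (1728 * (r + r') ^ 2 * Real.sqrt σ)) = 864 * NP * Real.sqrt σ * (β * (r + r') ^ 2) := by ring
      rw [this]; nlinarith only [hτ2, mul_nonneg hNP0 hsσ]
    have t3 : β / 2 * (NP * (σ / 2 * (29376 * (r + r') ^ 3 + 700569 * (r + r') ^ 4))) ≤
        NP * (σ / 2) * (14688 * (Real.sqrt β)⁻¹ * (2 * S + 4 * S ^ 2) + 700569 / 2 * (β⁻¹ * (4 * S ^ 2))) := by
      have : β / 2 * (NP * (σ / 2 * (29376 * (r + r') ^ 3 + 700569 * (r + r') ^ 4))) =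
          NP * (σ / 2) * (14688 * (β * (r + r') ^ 3) + 700569 / 2 * (β * (r + r') ^ 4)) := by ring
      rw [this]
      have hc : 0 ≤ NP * (σ / 2) := by positivity
      exact mul_le_mul_of_nonneg_left (by nlinarith only [hτ3, hτ4]) hc
    have t4 : β / 2 * (NP * (700000 * τu * (r + r') ^ 3)) ≤ 350000 * NP * τu * ((Real.sqrt β)⁻¹ * (2 * S + 4 * S ^ 2)) := by
      have : β / 2 * (NP * (700000 * τu * (r + r') ^ 3)) = 350000 * NP * τu * (β * (r + r') ^ 3) := by ring
      rw [this]; exact mul_le_mul_of_nonneg_left hτ3 (by positivity)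
    have t5 : β / 2 * (145000000 * N3 * τu ^ 2 * w ^ 2) = 72500000 * N3 * τu ^ 2 * (β * w ^ 2) := by ring
    have esplit : β / 2 * (σ / 2 * (10 * Real.sqrt N3 * w) ^ 2 +
        NP * (1728 * (r + r') ^ 2 * Real.sqrt σ + σ / 2 * (29376 * (r + r') ^ 3 + 700569 * (r + r') ^ 4) + 700000 * τu * (r + r') ^ 3) +
        145000000 * N3 * τu ^ 2 * w ^ 2) =
        β / 2 * (σ / 2 * (10 * Real.sqrt N3 * w) ^ 2) + β / 2 * (NP * (1728 * (r + r') ^ 2 * Real.sqrt σ)) +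
          β / 2 * (NP * (σ / 2 * (29376 * (r + r') ^ 3 + 700569 * (r + r') ^ 4))) + β / 2 * (NP * (700000 * τu * (r + r') ^ 3)) +
          β / 2 * (145000000 * N3 * τu ^ 2 * w ^ 2) := by ring
    rw [esplit, t1, t5]; linarith only [t2, t3, t4]
  have hbv := hbr r hr0
  have hbv' := hbr r' hr'0
  rw [e1]
  -- collect
  set Λ₁ := 1 + N + β * r ^ 2 + β * r' ^ 2 with hΛ₁
  set Q := (1 + β * r ^ 2 + β * r' ^ 2) ^ 2 with hQ
  have hΛ₁0 : 0 ≤ Λ₁ := by rw [hΛ₁]; positivity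
  have hQ0 : 0 ≤ Q := by rw [hQ]; positivity
  have hS1 : S ≤ Λ₁ := by rw [hSdef, hΛ₁]; linarith only [hN0]
  have hQS : Q = (1 + S) ^ 2 := by rw [hQ, hSdef]; ring
  have hS2 : 2 * S + 4 * S ^ 2 ≤ 4 * Q := by rw [hQS]; nlinarith only [hS0]
  have hS3 : 4 * S ^ 2 ≤ 4 * Q := by rw [hQS]; nlinarith only [hS0]
  -- termwise
  have ta := mul_le_mul_of_nonneg_left hS1 (by positivity : (0 : ℝ) ≤ 25 * σ * N3)
  have tb := mul_le_mul_of_nonneg_left hS1 (by positivity : (0 : ℝ) ≤ 1728 * NP * Real.sqrt σ)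
  have tc := mul_le_mul_of_nonneg_left (mul_le_mul_of_nonneg_left hS2 hsβi) (by positivity : (0 : ℝ) ≤ NP * (σ / 2) * 14688)
  have td := mul_le_mul_of_nonneg_left (mul_le_mul_of_nonneg_left hS3 hβi) (by positivity : (0 : ℝ) ≤ NP * (σ / 2) * (700569 / 2))
  have te := mul_le_mul_of_nonneg_left (mul_le_mul_of_nonneg_left hS2 hsβi) (by positivity : (0 : ℝ) ≤ 350000 * NP * τu)
  have tf := mul_le_mul_of_nonneg_left hS1 (by positivity : (0 : ℝ) ≤ 72500000 * N3 * τu ^ 2)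
  have tg := mul_le_mul_of_nonneg_left hK' (by positivity : (0 : ℝ) ≤ 48 * τu ^ 2)
  have n1 : 0 ≤ NP * σ * (Real.sqrt β)⁻¹ * Q := by positivity
  have n2 : 0 ≤ NP * σ * β⁻¹ * Q := by positivity
  have n3 : 0 ≤ NP * τu * (Real.sqrt β)⁻¹ * Q := by positivity
  have n4 : 0 ≤ NP * Real.sqrt σ * Λ₁ := by positivity
  have hSsplit : S = β * r ^ 2 + β * r' ^ 2 := hSdef
  linarith only [hbv, hbv', ta, tb, tc, td, te, tf, tg, n1, n2, n3, n4, hSsplit, hK0, hΛ₁0, hQ0]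

end Summit.QuantumFields.YangMills.Theorems.FemtoTransferGap.RateTube

end
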